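/-
Copyright (c) 2026. All rights reserved.
Released under Apache 2.0 license as described in the file LICENSE.
Authors: abc-iut cell, block C / W6 prover seat abc-iut-w6-d060 (gen 3).
-/
import Literature.IUT.LogVolume.UnitLogFirstTieLevelRoots
import Literature.IUT.LogVolume.UnitLogInnerRadiusTieRootsOfUnity
import HarnessLib

/-!
# `log_p(𝒪_K^×)` at the FIRST TIE LEVEL, III: the SPHERE `{‖z‖ = ‖ϖ‖ˢ}` when `ζ_p ∈ K` — MISSED iff `f = 1`,
# MET PROPERLY iff `f ≥ 2`

PROOF-ONLY sequel (no `def`, no named fact) of `UnitLogFirstTieLevel(Roots).lean` (abc-iut-w6-d060) and of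
abc-iut-c312-3's `UnitLogInnerRadiusTieRootsOfUnity.lean`.  Setting: `K` a proper ultrametric normed `ℚ_p`-algebra
field, `p` ODD, `e = absRamificationIdx p K = s·(p−1)` with `p ∤ s`, `ϖ` a norm uniformizer, `c = ϖ^{s(p−1)}/p`,
`L = log_p(𝒪_K^×) = logUnits K`, `f = residueDegree p K`, and `K ∋ ζ ≠ 1` with `ζ^p = 1`.

The tree decides the BALLS at such a place: `𝔪^{s+1} ⊆ L`, `𝔪ˢ ⊄ L` (`r_in = s + 1`, abc-iut-c312-3
`LogEnvelope.innerRadius_tie_of_pow_prime_eq_one`), and without `ζ_p` the whole three-valued valuation profile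
(abc-iut-rp-d4 `UnitLogValuationProfile*` under (NZ)).  What the `ζ_p`-PRESENT profile does AT the tie level `t = s`
was left open («cancellation cosets at tie levels … not treated»).  This file decides it — the generalisation of
this seat's (W2)/(W3) (`e = p − 1`, `UnitLogBoundaryRamificationTrichotomy`) from `s = 1` to every `s` prime to `p`:

* §1 a principal unit whose logarithm lies in `𝔪ˢ` either has its logarithm already in `𝔪^{s+1}` or sits EXACTLY
  at level `s` (`norm_logSeries_le_pow_succ_or_level_eq`; abc-iut-c312-3's off-level envelopes
  `exists_exponent_norm_logSeries_off_level` BY NAME);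
* §2 **`f = 1` ⇒ MISSED: `L ∩ 𝔪ˢ = 𝔪^{s+1}`** (`logUnits_inter_closedBall_pow_eq_of_residueDegree_eq_one`): the
  residue field has `p` elements and the additive residue polynomial `ā ↦ ā + c̄·ā^p` a non-zero zero
  `(ζ − 1)/ϖˢ`, so it vanishes identically and every level-`s` logarithm lies in `𝔪^{s+1}` (key congruence,
  part I); hence **no log-unit has norm `‖ϖ‖ˢ`** (`norm_ne_pow_of_mem_logUnits_of_residueDegree_eq_one`);
* §3 **`f ≥ 2` ⇒ MET** (ANY `s ≥ 1`, with or without `ζ_p`, no `p ∤ s` needed): `L` contains an element of norm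
  EXACTLY `‖ϖ‖ˢ` (`exists_mem_logUnits_norm_eq_pow_of_two_le_residueDegree`): a non-zero additive polynomial of
  degree `p` cannot vanish on a field with more than `p` elements, so some `a ∈ 𝒪` has `a + c·a^p ∈ 𝒪^×`, and then
  `‖log_p(1 + ϖˢa)‖ = ‖ϖ‖ˢ` by the key congruence;
* §4 **`ζ_p ∈ K`, `f ≥ 2` ⇒ MET PROPERLY** (`sphere_pow_meets_properly_of_pow_prime_eq_one`): an element of norm
  `‖ϖ‖ˢ` inside `L` AND one outside (abc-iut-c312-3's `exists_norm_eq_not_mem_logUnits_of_pow_prime_eq_one`);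
  and the DICHOTOMY `(∃ z ∈ L, ‖z‖ = ‖ϖ‖ˢ) ⟺ 2 ≤ f` at a `ζ_p`-field (`exists_mem_logUnits_norm_eq_pow_iff_two_le`).

So at a tie place with `ζ_p ∈ K_w` (`p ∤ e_w/(p−1)`) the R-H I06⋆ cell at `t = e_w/(p−1)` reads MISS if `f_w = 1`
and MEETS-PROPERLY (OPEN for a norm-specified element) if `f_w ≥ 2`; the cells `t ≥ s + 1` are IN and the BALL
cells `t ≤ s` are NOT-IN by the tree.  References: [cite: Washington1997, Lemma 1.4, §5.1]
[cite: NeukirchANT1999, Ch. II Prop. (5.5)–(5.7)].  Classical `p`-adic analysis; nothing here is disputed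
mathematics; no IUT statement is asserted; the name `logUnits` is the cell's typing of [IUTchIV] Prop. 1.2's
`log_p(R^×)` ([claim: Mochizuki2012, status: disputed] for that locution only).  No side is taken on
[IUTchIII] Cor. 3.12 or on any author.
-/

noncomputable section

open Metric Set IsUltrametricDist IsLocalRing
open scoped Pointwise NormedField

namespace Literature.IUT.LogVolume

open Literature.NumberTheory.GaloisRepresentations.Ultrametric Literature.NumberTheory.Transcendental
  BoundaryRamification

namespace FirstTieLevel

variable (p : ℕ) [hp : Fact p.Prime]
variable {K : Type*} [NontriviallyNormedField K] [instK : NormedAlgebra ℚ_[p] K] [IsUltrametricDist K]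
  [ProperSpace K]
variable {ϖ : Kˣ} (hϖ : IsUniformizer ϖ) {s : ℕ} (he : absRamificationIdx p K = s * (p - 1))
include hϖ he

/-! ## 1. A logarithm in `𝔪ˢ` comes from level exactly `s`, unless it is already in `𝔪^{s+1}` -/

omit hp instK [IsUltrametricDist K] [ProperSpace K] he in
/-- The LEVEL of a principal unit `y ≠ 1` as a natural number: `‖1 − y‖ = ‖ϖ‖ᵏ`, `k ≥ 1` (discreteness).
[cite: NeukirchANT1999, Ch. II Prop. (3.8)] -/
theorem exists_level {y : K} (hy : IsPrincipal y) (hy1 : y ≠ 1) :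
    ∃ k : ℕ, 1 ≤ k ∧ ‖1 - y‖ = ‖(ϖ : K)‖ ^ k := by
  have h0 : (1 : K) - y ≠ 0 := sub_ne_zero.mpr (Ne.symm hy1)
  obtain ⟨k, hk⟩ := hϖ.2 (Units.mk0 (1 - y) h0)
  rw [Units.val_mk0] at hk
  have hk1 : 1 ≤ k := by
    have hlt : ‖(ϖ : K)‖ ^ k < 1 := by rw [← hk]; exact hy
    have := (zpow_lt_one_iff_right_of_lt_one₀ (norm_units_pos ϖ) hϖ.norm_lt_one).mp hlt
    omega
  refine ⟨k.toNat, by omega, ?_⟩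
  rw [hk, ← zpow_natCast, Int.toNat_of_nonneg (by omega)]

/-- **A principal unit whose logarithm lies in `𝔪ˢ` has its logarithm in `𝔪^{s+1}` OR has level exactly `s`**
(`p ∤ s`): off the critical level the logarithm has norm `‖ϖ‖^β` with `β ≤ s − 2` (excluded by `‖L(y)‖ ≤ ‖ϖ‖ˢ`) or
`β ≥ s + 1` (abc-iut-c312-3's `LogEnvelope.exists_exponent_norm_logSeries_off_level`).
[cite: NeukirchANT1999, Ch. II Prop. (5.5)] -/
theorem norm_logSeries_le_pow_succ_or_level_eq (hps : ¬ p ∣ s) {y : K} (hy : IsPrincipal y)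
    (hL : ‖logSeries y‖ ≤ ‖(ϖ : K)‖ ^ s) :
    ‖logSeries y‖ ≤ ‖(ϖ : K)‖ ^ (s + 1) ∨ ‖1 - y‖ = ‖(ϖ : K)‖ ^ s := by
  have hr0 : 0 < ‖(ϖ : K)‖ := norm_units_pos ϖ
  have hr1 : ‖(ϖ : K)‖ < 1 := hϖ.norm_lt_one
  rcases eq_or_ne y 1 with h1 | h1
  · left
    rw [h1, logSeries_one, norm_zero]; positivity
  obtain ⟨k, hk1, hk⟩ := exists_level hϖ hy h1
  rcases eq_or_ne k s with hks | hks
  · right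
    rw [hk, hks]
  · left
    have hk' : ‖1 - y‖ = ‖(ϖ : K)‖ ^ (k : ℤ) := by rw [hk, zpow_natCast]
    obtain ⟨β, hβ, hcases⟩ := LogEnvelope.exists_exponent_norm_logSeries_off_level p hϖ he hps
      (s := (k : ℤ)) (by exact_mod_cast hk1) hk' (by exact_mod_cast hks)
    rcases hcases with hlo | hhi
    · exfalso
      rw [hβ, ← zpow_natCast] at hL
      have := (zpow_le_zpow_iff_right_of_lt_one₀ hr0 hr1).mp hL
      omega
    · rw [hβ, ← zpow_natCast]
      exact zpow_le_zpow_right_of_le_one₀ hr0 hr1.le (by push_cast; omega)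

/-! ## 2. `ζ_p ∈ K`, `f = 1`: the sphere at the tie level is MISSED — `L ∩ 𝔪ˢ = 𝔪^{s+1}` -/

/-- **THE SPHERE AT THE TIE LEVEL, `ζ_p ∈ K`, `f = 1`: MISSED** — `log_p(𝒪_K^×) ∩ 𝔪ˢ = 𝔪^{s+1}` (`e = s(p−1)`,
`p` odd, `p ∤ s`): the residue field has `p` elements and the residue polynomial `ā ↦ ā + c̄·ā^p` the non-zero zero
`(ζ − 1)/ϖˢ` (part II), so it vanishes identically — every level-`s` logarithm lies in `𝔪^{s+1}` (key congruence,
part I); other levels do not reach the sphere (§1).  For `s = 1` this is (W2) `log_p(𝒪^×) = 𝔪²` for `K ≅ ℚ_p(ζ_p)`.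
[cite: Washington1997, Lemma 1.4, §5.1] [cite: NeukirchANT1999, Ch. II Prop. (5.7)] -/
theorem logUnits_inter_closedBall_pow_eq_of_residueDegree_eq_one (hp2 : p ≠ 2) (hps : ¬ p ∣ s) {ζ : K}
    (hζ : ζ ^ p = 1) (hζ1 : ζ ≠ 1) (hf : residueDegree p K = 1) :
    logUnits K ∩ closedBall (0 : K) (‖(ϖ : K)‖ ^ s) = closedBall (0 : K) (‖(ϖ : K)‖ ^ (s + 1)) := by
  have hr0 : 0 < ‖(ϖ : K)‖ := norm_units_pos ϖ
  have hr1 : ‖(ϖ : K)‖ < 1 := hϖ.norm_lt_one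
  refine Set.Subset.antisymm ?_ fun z hz => ⟨closedBall_pow_succ_subset_logUnits p hϖ he hz,
    closedBall_subset_closedBall (pow_le_pow_of_le_one hr0.le hr1.le (Nat.le_succ s)) hz⟩
  have hc1 : ‖((ϖ : K) ^ s) ^ (p - 1) / p‖ = 1 := norm_coeff_eq_one p (norm_pow_level_pow_eq p hϖ he)
  let C : Valued.integer K := ⟨((ϖ : K) ^ s) ^ (p - 1) / p, Valued.integer.mem_iff.mpr hc1.le⟩
  haveI := charP_residueField p K
  haveI : Finite (ResidueField (Valued.integer K)) := finite_residueField
  -- a non-zero zero of the residue polynomial, from `ζ`; `#k = p`, so it vanishes identically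
  obtain ⟨a₁, ha₁, -, hΛ₁⟩ := exists_norm_eq_one_norm_add_mul_pow_lt_one p hϖ he hp2 hζ hζ1
  obtain ⟨x₁, hx₁, hφ₁⟩ := exists_ne_zero_addPoly_eq_zero_of_norm p C ha₁ hΛ₁
  have hcard : Nat.card (ResidueField (Valued.integer K)) = p := by
    rw [card_residueField p K, hf, pow_one]
  have h0 := forall_addPoly_eq_zero_of_natCard_eq p _ hcard hx₁ hφ₁
  have hK := norm_add_mul_pow_lt_one_of_forall_addPoly_eq_zero p C h0
  rintro z ⟨hzL, hz⟩
  rw [mem_closedBall, dist_zero_right] at hz ⊢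
  obtain ⟨u, hu, rfl⟩ := hzL
  rw [Set.mem_setOf_eq] at hu
  obtain ⟨m, hm, hpm, hmP⟩ := exists_pow_isPrincipal_not_dvd (p := p) hu
  have hm1 : ‖((m : ℕ) : K)‖ = 1 := by
    rw [norm_natCast_eq_padicNorm p K m, Padic.norm_natCast_eq_one_iff]
    exact (Nat.Prime.coprime_iff_not_dvd hp.out).mpr hpm
  rw [unitLog_eq_inv_mul_logSeries p hm hmP, norm_mul, norm_inv, hm1, inv_one, one_mul] at hz ⊢
  -- either `L(u^m) ∈ 𝔪^{s+1}` already, or `u^m` has level `s`: `u^m = 1 + ϖˢa` and `L(u^m) ∈ 𝔪^{s+1}`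
  rcases norm_logSeries_le_pow_succ_or_level_eq p hϖ he hps hmP hz with h | hlev
  · exact h
  · obtain ⟨a, ha, hy⟩ := exists_eq_one_add_pow_mul_of_le hlev.le
    rw [hy]
    exact norm_logSeries_le_pow_succ_of_norm_lt_one p hϖ he hp2 ha (hK a ha)

/-- **No log-unit has norm `‖ϖ‖ˢ`** when `ζ_p ∈ K` and `f = 1` (`e = s(p−1)`, `p` odd, `p ∤ s`): the sphere at the tie
level MISSES `log_p(𝒪_K^×)`. [cite: Washington1997, Lemma 1.4, §5.1] -/
theorem norm_ne_pow_of_mem_logUnits_of_residueDegree_eq_one (hp2 : p ≠ 2) (hps : ¬ p ∣ s) {ζ : K}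
    (hζ : ζ ^ p = 1) (hζ1 : ζ ≠ 1) (hf : residueDegree p K = 1) {z : K} (hz : z ∈ logUnits K) :
    ‖z‖ ≠ ‖(ϖ : K)‖ ^ s := by
  intro hEq
  have hmem : z ∈ logUnits K ∩ closedBall (0 : K) (‖(ϖ : K)‖ ^ s) :=
    ⟨hz, by rw [mem_closedBall, dist_zero_right, hEq]⟩
  rw [logUnits_inter_closedBall_pow_eq_of_residueDegree_eq_one p hϖ he hp2 hps hζ hζ1 hf,
    mem_closedBall, dist_zero_right, hEq, pow_succ] at hmem
  have hr0 : 0 < ‖(ϖ : K)‖ ^ s := pow_pos (norm_units_pos ϖ) s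
  have : ‖(ϖ : K)‖ ^ s * 1 ≤ ‖(ϖ : K)‖ ^ s * ‖(ϖ : K)‖ := by rwa [mul_one]
  exact absurd (le_of_mul_le_mul_left this hr0) (not_le.mpr hϖ.norm_lt_one)

/-- The sphere at the tie level is DISJOINT from `log_p(𝒪_K^×)` when `ζ_p ∈ K`, `f = 1` (set form).
[cite: Washington1997, Lemma 1.4, §5.1] -/
theorem logUnits_inter_sphere_pow_eq_empty_of_residueDegree_eq_one (hp2 : p ≠ 2) (hps : ¬ p ∣ s) {ζ : K}
    (hζ : ζ ^ p = 1) (hζ1 : ζ ≠ 1) (hf : residueDegree p K = 1) :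
    logUnits K ∩ sphere (0 : K) (‖(ϖ : K)‖ ^ s) = ∅ := by
  ext z
  simp only [Set.mem_inter_iff, mem_sphere, dist_zero_right, Set.mem_empty_iff_false, iff_false, not_and]
  exact fun hz => norm_ne_pow_of_mem_logUnits_of_residueDegree_eq_one p hϖ he hp2 hps hζ hζ1 hf hz

/-! ## 3. `f ≥ 2`: the sphere at the tie level is MET (any `s`, with or without `ζ_p`) -/

/-- **THE SPHERE AT THE TIE LEVEL IS MET when `f ≥ 2`** — `log_p(𝒪_K^×)` contains an element of norm EXACTLY
`‖ϖ‖ˢ` (`e = s(p−1)`, `p` odd; ANY `s`, whether or not `ζ_p ∈ K`): the residue polynomial `ā ↦ ā + c̄·ā^p`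
(`c̄ ≠ 0`) cannot vanish on a field with more than `p` elements (this seat's `natCard_le_of_forall_addPoly_eq_zero`),
so some `a ∈ 𝒪` has `a + c·a^p` a unit, and then `‖log_p(1 + ϖˢa)‖ = ‖ϖ‖ˢ` by the key congruence (part I).
For `s = 1` this is `exists_mem_logUnits_norm_eq` of the boundary trichotomy. [cite: Washington1997, §5.1] -/
theorem exists_mem_logUnits_norm_eq_pow_of_two_le_residueDegree (hp2 : p ≠ 2)
    (hf : 2 ≤ residueDegree p K) : ∃ z ∈ logUnits K, ‖z‖ = ‖(ϖ : K)‖ ^ s := by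
  have hr0 : 0 < ‖(ϖ : K)‖ := norm_units_pos ϖ
  have hr1 : ‖(ϖ : K)‖ < 1 := hϖ.norm_lt_one
  have h1 := one_le_level p he
  have hπ := norm_pow_level_pow_eq p hϖ he
  have hc1 : ‖((ϖ : K) ^ s) ^ (p - 1) / p‖ = 1 := norm_coeff_eq_one p hπ
  let C : Valued.integer K := ⟨((ϖ : K) ^ s) ^ (p - 1) / p, Valued.integer.mem_iff.mpr hc1.le⟩
  haveI := charP_residueField p K
  haveI : Finite (ResidueField (Valued.integer K)) := finite_residueField
  -- the residue polynomial does not vanish identically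
  have hex : ∃ a : K, ‖a‖ ≤ 1 ∧ ‖a + (C : K) * a ^ p‖ = 1 := by
    by_contra hnone
    push Not at hnone
    have hK : ∀ a : K, ‖a‖ ≤ 1 → ‖a + (C : K) * a ^ p‖ < 1 := by
      intro a ha
      have hle : ‖a + (C : K) * a ^ p‖ ≤ 1 := by
        refine (norm_add_le_max _ _).trans (max_le ha ?_)
        rw [norm_mul, hc1, one_mul, norm_pow]; exact pow_le_one₀ (norm_nonneg _) ha
      exact lt_of_le_of_ne hle (hnone a ha)
    have h0 := forall_addPoly_eq_zero_of_norm p C hK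
    have hγ : residue (Valued.integer K) C ≠ 0 := residue_ne_zero_of_norm_eq_one C hc1
    have hle := natCard_le_of_forall_addPoly_eq_zero p hγ h0
    rw [card_residueField p K] at hle
    have h2 : p ^ 2 ≤ p ^ residueDegree p K := Nat.pow_le_pow_right hp.out.pos hf
    have hlt : p < p ^ 2 := by rw [pow_two]; exact lt_mul_self hp.out.one_lt
    omega
  obtain ⟨a, ha, hΛ⟩ := hex
  refine ⟨logSeries (1 + (ϖ : K) ^ s * a), logSeries_one_add_pow_mul_mem_logUnits p hϖ he ha, ?_⟩
  -- key congruence: `‖L(1 + ϖˢa) − ϖˢ(a + c a^p)‖ ≤ ‖ϖ‖^{2s} < ‖ϖ‖ˢ = ‖ϖˢ(a + c a^p)‖`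
  have hmain : ‖(ϖ : K) ^ s * (a + (C : K) * a ^ p)‖ = ‖(ϖ : K)‖ ^ s := by
    rw [norm_mul, hΛ, mul_one, norm_pow]
  have hsmall : ‖logSeries (1 + (ϖ : K) ^ s * a) - (ϖ : K) ^ s * (a + (C : K) * a ^ p)‖ <
      ‖(ϖ : K) ^ s * (a + (C : K) * a ^ p)‖ := by
    refine (norm_logSeries_one_add_sub_le p hπ hp2 ha).trans_lt ?_
    rw [hmain, norm_pow, ← pow_mul]
    exact pow_lt_pow_right_of_lt_one₀ hr0 hr1 (by omega)
  calc ‖logSeries (1 + (ϖ : K) ^ s * a)‖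
      = ‖(logSeries (1 + (ϖ : K) ^ s * a) - (ϖ : K) ^ s * (a + (C : K) * a ^ p)) +
          (ϖ : K) ^ s * (a + (C : K) * a ^ p)‖ := by rw [sub_add_cancel]
    _ = ‖(ϖ : K) ^ s * (a + (C : K) * a ^ p)‖ :=
        (norm_add_eq_max_of_norm_ne_norm hsmall.ne).trans (max_eq_right hsmall.le)
    _ = ‖(ϖ : K)‖ ^ s := hmain

/-! ## 4. `ζ_p ∈ K`, `f ≥ 2`: MET PROPERLY; the dichotomy in `f` -/

/-- **THE SPHERE AT THE TIE LEVEL, `ζ_p ∈ K`, `f ≥ 2`: MET PROPERLY** (`e = s(p−1)`, `p` odd, `p ∤ s`): there are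
elements of norm EXACTLY `‖ϖ‖ˢ` inside `log_p(𝒪_K^×)` (§3) and outside it (abc-iut-c312-3's
`LogEnvelope.exists_norm_eq_not_mem_logUnits_of_pow_prime_eq_one`): for an element known only by its norm,
membership is UNDECIDED on this sphere.  For `s = 1` this is (W3) of the boundary trichotomy.
[cite: Washington1997, §5.1] [cite: NeukirchANT1999, Ch. II Prop. (5.7)] -/
theorem sphere_pow_meets_properly_of_pow_prime_eq_one (hp2 : p ≠ 2) (hps : ¬ p ∣ s) {ζ : K} (hζ : ζ ^ p = 1)
    (hζ1 : ζ ≠ 1) (hf : 2 ≤ residueDegree p K) :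
    (∃ z ∈ logUnits K, ‖z‖ = ‖(ϖ : K)‖ ^ s) ∧ ∃ w : K, ‖w‖ = ‖(ϖ : K)‖ ^ s ∧ w ∉ logUnits K :=
  ⟨exists_mem_logUnits_norm_eq_pow_of_two_le_residueDegree p hϖ he hp2 hf,
    LogEnvelope.exists_norm_eq_not_mem_logUnits_of_pow_prime_eq_one p hϖ he hp2 hps hζ hζ1⟩

/-- **THE DICHOTOMY IN `f` at a `ζ_p`-field** (`e = s(p−1)`, `p` odd, `p ∤ s`, `K ∋ ζ_p ≠ 1`): the sphere
`{‖z‖ = ‖ϖ‖ˢ}` meets `log_p(𝒪_K^×)` **iff `f ≥ 2`**. [cite: Washington1997, Lemma 1.4, §5.1] -/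
theorem exists_mem_logUnits_norm_eq_pow_iff_two_le (hp2 : p ≠ 2) (hps : ¬ p ∣ s) {ζ : K} (hζ : ζ ^ p = 1)
    (hζ1 : ζ ≠ 1) : (∃ z ∈ logUnits K, ‖z‖ = ‖(ϖ : K)‖ ^ s) ↔ 2 ≤ residueDegree p K := by
  constructor
  · rintro ⟨z, hz, hzn⟩
    by_contra hlt
    have hf : residueDegree p K = 1 := by
      have := residueDegree_pos p K
      omega
    exact norm_ne_pow_of_mem_logUnits_of_residueDegree_eq_one p hϖ he hp2 hps hζ hζ1 hf hz hzn
  · exact exists_mem_logUnits_norm_eq_pow_of_two_le_residueDegree p hϖ he hp2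

/-- **Summary at a `ζ_p`-field, `f = 1`** (`e = s(p−1)`, `p` odd, `p ∤ s`): the trace of `log_p(𝒪_K^×)` on the closed
ball of the tie level is EXACTLY the next ball — `{z ∈ log_p(𝒪_K^×) : ‖z‖ ≤ ‖ϖ‖ˢ} = {‖z‖ ≤ ‖ϖ‖^{s+1}}` — while
`log_p(𝒪_K^×) ⊄ 𝔪ˢ⁺¹` as soon as `s ≥ 2` is NOT claimed (lower levels contribute norms `≥ ‖ϖ‖^{s−2}`); together with
abc-iut-c312-3's `innerRadius_tie_of_pow_prime_eq_one` (`r_in = s + 1`) this is the complete picture of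
`log_p(𝒪_K^×)` on `𝔪ˢ`. [cite: Washington1997, Lemma 1.4, §5.1] -/
theorem mem_logUnits_and_norm_le_pow_iff_of_residueDegree_eq_one (hp2 : p ≠ 2) (hps : ¬ p ∣ s) {ζ : K}
    (hζ : ζ ^ p = 1) (hζ1 : ζ ≠ 1) (hf : residueDegree p K = 1) (z : K) :
    z ∈ logUnits K ∧ ‖z‖ ≤ ‖(ϖ : K)‖ ^ s ↔ ‖z‖ ≤ ‖(ϖ : K)‖ ^ (s + 1) := by
  have h := logUnits_inter_closedBall_pow_eq_of_residueDegree_eq_one p hϖ he hp2 hps hζ hζ1 hf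
  have hz := Set.ext_iff.mp h z
  simp only [Set.mem_inter_iff, mem_closedBall, dist_zero_right] at hz
  exact hz

end FirstTieLevel

end Literature.IUT.LogVolume

end
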